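import Summits.QuantumFields.YangMills.Theorems.UnitScaleTiltProp7ExistRouteAlphaMinS
import Summits.QuantumFields.YangMills.Theorems.UnitScaleTiltProp7SPrintDefsS
import HarnessLib

/-!
# Route `UnitScaleTilt`, crux K1 child «MinimiserStabilityRegPr» (stmt-QuantumFields-19200), skeleton v10, stub `stub_existenceMinimalOrbit` (EX), route (α) — **ROUTE (α) SPINE v2ˢ,
# (21)-LETTER GENERIC (display place (d), ★★OWNER ACK 34 (1); knit ruler's plan ≈09:34Z): the MINIMISER-side (21) is an ARBITRARY predicate `Lan` (the knit instantiates
# `IsLandauPrintS … (c₀ L) (cB L) U₀`); the competitor binder keeps print's `IsLandauPrint` (lit `Thm2TorusAt` via ✓`cov_of_thm2TorusAt`); (21) is never unfolded here — otherwise THE (α-S) COPY OF ✓`Prop7ExistRouteAlphaMin.existenceMinimalOrbit_of_Cmin_cov` (✓`…_of_CminS_cov` is the instance `Lan := IsLandauPrint`)** (★★OWNER RULING g26-№19 «(α-S) ADOPTED — the slice is RE-BASED with the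
# chart: `AvgCondPrintS`»; knit ruler's letter plan (J1), bus 2026-08-28 ≈08:55Z): the minimising chart point `X` of C-min carries the RE-BASED (20) `AvgCondPrintS V U₀ X` (symmetric
# slice Σ_kˢ, explicit `NormS` witness — what the chart of record `logChartTwS` produces), while the COMPETITOR binder keeps print's comb (20) `AvgCondPrint V U₀ X′` — exactly what
# COV (✓`Prop7CovOfThm2.cov_of_thm2TorusAt`, from [Balaban1985RegularSpaces] Thm 2 verbatim) supplies.  No bridge between the two slices is needed: the spine reads the minimiser's
# (20) only through its fibre clause «`(e^{iX}U₀)^u ∈ 𝔅_k(V)`» (regularity of the representative is GAUGE-INVARIANT, ✓`regPr_gaugeAct_iff` + ✓`regPr_emb15_of_in19`), and hands the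
# competitor's (20) to C-min's binder verbatim

Cell `ym3-torus`, width seat `ym-ust-19200-w2` (gen 3; EX KNIT RULER, RULING g26-№19 ORDER (2) file F1).  THEOREMS ONLY (0 `def`, 0 `sorry`).  By-name bookkeeping: nothing here
closes the stub; `--supports stmt-QuantumFields-19200 --as helper`, count-neutral.  YM₃ on T³ is a ladder rung (R3), not the Clay problem; nothing here claims the stub, the crux,
d = 4 or the mass gap.

THE PRINT.  [Balaban1985Variational] p. 299, Prop. 7: «the configuration U₁ described in Proposition 6 is a unique minimum of the functional A(U₁U₀) on the space (6) with
ε₀ sufficiently small»; p. 281 (20)–(21) and [Balaban1985RegularSpaces] (1.28)–(1.30) p. 81: the slice «U′ = (U₁U₀)^u in the axial gauge (1.19) with u restricted … Ũ′ʲ = V(Ū₀ʲ)⁻¹»;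
Thm 2 p. 83 of [Balaban1985RegularSpaces]: every regular axial `U′` near `U₀` is so charted.  THE RE-BASE (RULING g26-№19): the witness `u` of the MINIMISER's (20) is normalised by
(1.19) and the symmetric top-centre clause `u↓(y) = (w^{sym}_{iX}(y))⁻¹` (`Prop7SPrint.NormS`) instead of (1.29) — the EX stub speaks of ORBITS meeting the regular fibre, and the
spine consumes of any (20) only «the orbit of `e^{iX}U₀` meets `𝔅_k(V)`».

WHAT IS PROVED (sorry-free).  ★★ **`existenceMinimalOrbit_of_CminG_cov`** ((21)-letter generic twin of ✓`existenceMinimalOrbit_of_CminS_cov`) — the registered EX text at `(L, B₃)`, `B₃ > 4`, FROM (i) **C-minˢ**: `∃ B₀ a₄ > 0, ∀ i ε₁ ε₄ …, ∃ X`,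
`nMax19 X < 3B₀L³B₃ε₁`, Hermitian-traceless, **`AvgCondPrintS V U₀ X`**, `Lan i U₀ X`, and `A(e^{iX}U₀) ≤ A(e^{iX′}U₀)` for every competitor `X′` with (19) at `ε₄`,
Hermitian-traceless, print's **`AvgCondPrint V U₀ X′`**, `IsLandauPrint U₀ X′`; (ii) **COV** VERBATIM as in ✓`existenceMinimalOrbit_of_Cmin_cov` (print's letters `RestrictedPrint`,
`In19`, `AvgCondPrint`, `IsLandauPrint` for the axial competitor).  PROOF = the ✓ spine's, token for token, except that the minimiser's (20) unfolds to `⟨u, NormS …, W ∈ 𝔅_k(V)⟩`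
(two components) — the normalisation is idle there exactly as `RestrictedPrint`∕`IsAxialPrint` were (`_hu`, `_hax` in the ✓ proof).  Constants unchanged:
`a₁′ = min{a₄/(2B₀L³B₃), a₄/(B₁(178M+1)L³B₃), c₁/((178M+1)L³B₃), e_ax/(178·M·L³B₃), 1/(4·M·L³B₃)}`, `O₁ = 178·M`, `M = max{1, 3B₀}`.

References: T. Bałaban, CMP 102 (1985) 277–309 [Balaban1985Variational] ((19)–(21) p.281, Prop. 6 p.295, Prop. 7 p.299, (112) p.294, (141)–(142) p.299); CMP 99 (1985) 75–102
[Balaban1985RegularSpaces] ((1.19) p.79, (1.28)–(1.30) p.81, Thm 2 p.83); CMP 98 (1985) 17–51 [Balaban1985Averaging] ((87) p.31).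
-/

set_option autoImplicit false

noncomputable section

open scoped Matrix.Norms.L2Operator

namespace Summit.QuantumFields.YangMills.Theorems.Prop7ExistRouteAlphaMinG

open Literature.MathematicalPhysics.QuantumFieldTheory.Balaban1983to89
open Literature.MathematicalPhysics.QuantumFieldTheory.Balaban1983to89.T3ContinuumYM3Torus
open Literature.MathematicalPhysics.QuantumFieldTheory.Balaban1983to89.T3UnitLawDensityEML (ℰp)
open Literature.MathematicalPhysics.QuantumFieldTheory.Balaban1983to89.T3DescentFibreTower
open Literature.MathematicalPhysics.QuantumFieldTheory.Balaban1983to89.T3ConstrainedMinimiser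
open Literature.MathematicalPhysics.QuantumFieldTheory.Balaban1983to89.T3TiltDescent
open Literature.MathematicalPhysics.QuantumFieldTheory.Balaban1983to89.T3PrintedRegularMinimiser
open Literature.MathematicalPhysics.QuantumFieldTheory.Balaban1983to89.T3PrintedMinimiserExistence (regPr_mono)
open Literature.MathematicalPhysics.QuantumFieldTheory.Balaban1983to89.T3PrintedRegularOrbits (descTransf regPr_gaugeAct_iff gaugeAct_mem_regFibrePr_iff_of_trivial)
open Literature.MathematicalPhysics.QuantumFieldTheory.Balaban1983to89.T3Thm1Carrier
open Literature.MathematicalPhysics.QuantumFieldTheory.Balaban1983to89.T3SectALandauChart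
open B7Prop2Explicit (C0 c2' C0_pos c2'_pos)
open B8Thm4TorusAt (torusLam)
open Summit.QuantumFields.YangMills.Theorems.Prop7TPrint
open Summit.QuantumFields.YangMills.Theorems.Prop7SPrint
open Summit.QuantumFields.YangMills.Theorems.Prop7PV3CDELogChart (in19_expHermField_of_nMax19_lt nMax19_lt_of_in19 eq_expHermField_of_in19)
open Summit.QuantumFields.YangMills.Theorems.Prop7B8Prop7Div (regPr_emb15_of_in19)
open Summit.QuantumFields.YangMills.Theorems.Prop7ChartPrint (axialRepr_print_based_uniform)

variable {L : ℕ}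

/-- ★★ **ROUTE (α) SPINE v2ˢ, (21)-LETTER GENERIC — `stub_existenceMinimalOrbit` ⇐ C-minˢ ∧ COV** (minimiser's (21) = `Lan i U₀ X`, arbitrary; the (α-S) copy of ✓`existenceMinimalOrbit_of_Cmin_cov`: the minimiser's (20) is the RE-BASED
`AvgCondPrintS` — symmetric slice, `NormS` witness; the competitor binder and COV keep print's comb `AvgCondPrint`): with `M = max{1, 3B₀}`, `e = 178·M·L³B₃ε₁`, C-minˢ's minimising
`X` ((112) ⇒ (19) at `M·L³B₃ε₁ ≤ ¼`), its `NormS`-representative `W = (e^{iX}U₀)^u ∈ 𝔘_k(e) ∩ 𝔅_k(V)` (gauge invariance of (6): ✓`regPr_gaugeAct_iff`); a competitor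
`U ∈ (6)(e) ∩ 𝔅_k(V)` is moved to the axial gauge inside its (4)-orbit ((1.19)), charted by COV at `ε₂ = B₁(e + L³ε₁) ≤ a₄` in print's comb slice, and compared through the gauge
invariance of (5).  `a₁′`, `O₁ = 178M` as in the ✓ spine. [cite: Balaban1985Variational, Prop. 7 p.299, (112) p.294, (116) p.295, (141)-(142) p.299; Balaban1985RegularSpaces, Thm 2 p.83, (1.19) p.79, (1.28)-(1.30) p.81] -/
theorem existenceMinimalOrbit_of_CminG_cov (hL : 1 < L) {B₃ : ℝ} (hB₃ : 4 < B₃) (Lan : ∀ i : Idx L, GaugeField (i.1.1.P i.1.2.2) 0 (Matrix.specialUnitaryGroup (Fin 2) ℂ) → (PBond (i.1.1.P i.1.2.2) 0 → Matrix (Fin 2) (Fin 2) ℂ) → Prop)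
    (hC : ∃ B₀ a₄ : ℝ, 0 < B₀ ∧ 0 < a₄ ∧ ∀ (i : Idx L) (ε₁ ε₄ : ℝ), 0 < ε₁ → ε₄ ≤ a₄ → 2 * B₀ * (L : ℝ) ^ 3 * B₃ * ε₁ ≤ ε₄ →
        ∀ (V : GaugeField (i.1.1.P i.1.2.1) 0 (Matrix.specialUnitaryGroup (Fin 2) ℂ)) (U₀ : GaugeField (i.1.1.P i.1.2.2) 0 (Matrix.specialUnitaryGroup (Fin 2) ℂ)),
          PlaqSmall ε₁ V → RegPr i.1.1 i.1.2.1 i.1.2.2 ((L : ℝ) ^ 3 * B₃ * ε₁) U₀ → CloseAvg i.1.1 i.1.2.1 i.1.2.2 i.2.2.le ((L : ℝ) ^ 3 * ε₁) V U₀ →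
          ∃ X : PBond (i.1.1.P i.1.2.2) 0 → Matrix (Fin 2) (Fin 2) ℂ,
            nMax19 i.1.1 i.1.2.1 i.1.2.2 U₀ X < 3 * B₀ * (L : ℝ) ^ 3 * B₃ * ε₁ ∧ (∀ b : PBond (i.1.1.P i.1.2.2) 0, (X b).IsHermitian ∧ Matrix.trace (X b) = 0) ∧
            AvgCondPrintS i.1.1 i.1.2.1 i.1.2.2 i.2.2.le V U₀ X ∧ Lan i U₀ X ∧
            ∀ X' : PBond (i.1.1.P i.1.2.2) 0 → Matrix (Fin 2) (Fin 2) ℂ, nMax19 i.1.1 i.1.2.1 i.1.2.2 U₀ X' < ε₄ → (∀ b : PBond (i.1.1.P i.1.2.2) 0, (X' b).IsHermitian ∧ Matrix.trace (X' b) = 0) →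
              AvgCondPrint i.1.1 i.1.2.1 i.1.2.2 i.2.2.le V U₀ X' → IsLandauPrint i.1.1 i.1.2.1 i.1.2.2 U₀ X' →
                wilsonAction4 (emb15 U₀ (expHermField X)) ≤ wilsonAction4 (emb15 U₀ (expHermField X')))
    (hV : ∃ B₁ c₁ : ℝ, 0 < B₁ ∧ 0 < c₁ ∧ ∀ (F : T3Family) (hF : F.L = L) (n K : ℕ) (hnK : n < K) (ε₀ ε₁ ε₂ : ℝ), 0 < ε₀ → 0 < ε₁ →
        ε₀ + (L : ℝ) ^ 3 * ε₁ ≤ c₁ → B₁ * (ε₀ + (L : ℝ) ^ 3 * ε₁) ≤ ε₂ →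
        ∀ (V : GaugeField (F.P n) 0 (Matrix.specialUnitaryGroup (Fin 2) ℂ)) (U₀ : GaugeField (F.P K) 0 (Matrix.specialUnitaryGroup (Fin 2) ℂ)),
          RegPr F n K ((L : ℝ) ^ 3 * B₃ * ε₁) U₀ → CloseAvg F n K hnK.le ((L : ℝ) ^ 3 * ε₁) V U₀ →
          ∀ U : GaugeField (F.P K) 0 (Matrix.specialUnitaryGroup (Fin 2) ℂ), U ∈ regFibrePr F n K hnK.le ε₀ V → IsAxialPrint F n K U₀ U →
            ∃ (u : GaugeTransf (F.P K) 0 (Matrix.specialUnitaryGroup (Fin 2) ℂ)) (U₁ : GaugeField (F.P K) 0 (Matrix.specialUnitaryGroup (Fin 2) ℂ))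
              (X : PBond (F.P K) 0 → Matrix (Fin 2) (Fin 2) ℂ),
              RestrictedPrint F n K U₀ u ∧ GaugeField.gaugeAct u (emb15 U₀ U₁) = U ∧ In19 F n K ε₂ U₀ U₁ X ∧
                AvgCondPrint F n K hnK.le V U₀ X ∧ IsLandauPrint F n K U₀ X) :
    ∃ a₁' O₁ : ℝ, 0 < a₁' ∧ 1 ≤ O₁ ∧
    ∀ (F : T3Family), F.L = L → ∀ (n K : ℕ) (hnK : n < K) (ε₁ : ℝ), 0 < ε₁ →
      ∀ V : GaugeField (F.P n) 0 (Matrix.specialUnitaryGroup (Fin 2) ℂ), PlaqSmall ε₁ V →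
        ∀ U₀ : GaugeField (F.P K) 0 (Matrix.specialUnitaryGroup (Fin 2) ℂ), RegPr F n K ((L : ℝ) ^ 3 * B₃ * ε₁) U₀ → U₀ ∈ fibre F ℰp n K hnK.le V →
          ε₁ ≤ a₁' → ∃ U ∈ regFibrePr F n K hnK.le (O₁ * (L : ℝ) ^ 3 * B₃ * ε₁) V,
            IsMinOn (fun W : GaugeField (F.P K) 0 (Matrix.specialUnitaryGroup (Fin 2) ℂ) => wilsonAction4 W)
              (regFibrePr F n K hnK.le (O₁ * (L : ℝ) ^ 3 * B₃ * ε₁) V) U := by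
  have hL1 : (1 : ℝ) ≤ (L : ℝ) := by exact_mod_cast hL.le
  have hC₁ : (1 : ℝ) ≤ (L : ℝ) ^ 3 := one_le_pow₀ hL1
  have hC₁pos : (0 : ℝ) < (L : ℝ) ^ 3 := by positivity
  have hB₃0 : 0 < B₃ := by linarith
  have hB₃1 : 1 ≤ B₃ := by linarith
  have hC0 : 0 < C0 3 := C0_pos _
  have hc2 : 0 < c2' 3 L := c2'_pos _ _ hL.le
  set eax : ℝ := min (1 / (6 * C0 3 * (L : ℝ) ^ 3)) (c2' 3 L / (4 * (L : ℝ) ^ 3)) with heax_def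
  have heax : 0 < eax := lt_min (by positivity) (by positivity)
  obtain ⟨B₀, a₄, hB₀, ha₄, HC⟩ := hC
  obtain ⟨B₁, c₁, hB₁, hc₁, HV⟩ := hV
  set M : ℝ := max 1 (3 * B₀) with hM
  have hM1 : 1 ≤ M := le_max_left _ _
  have hM3 : 3 * B₀ ≤ M := le_max_right _ _
  have hM0 : 0 < M := lt_of_lt_of_le one_pos hM1
  have hK₁ : 0 < 2 * B₀ * (L : ℝ) ^ 3 * B₃ := by positivity
  have hK₂ : 0 < B₁ * (178 * M + 1) * (L : ℝ) ^ 3 * B₃ := by positivity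
  have hK₃ : 0 < (178 * M + 1) * (L : ℝ) ^ 3 * B₃ := by positivity
  have hK₄ : 0 < 178 * M * (L : ℝ) ^ 3 * B₃ := by positivity
  have hK₅ : 0 < M * (L : ℝ) ^ 3 * B₃ := by positivity
  set a₁' : ℝ := min (min (min (min (a₄ / (2 * B₀ * (L : ℝ) ^ 3 * B₃)) (a₄ / (B₁ * (178 * M + 1) * (L : ℝ) ^ 3 * B₃))) (c₁ / ((178 * M + 1) * (L : ℝ) ^ 3 * B₃)))
    (eax / (178 * M * (L : ℝ) ^ 3 * B₃))) ((1 / 4) / (M * (L : ℝ) ^ 3 * B₃)) with ha₁'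
  have ha₁'0 : 0 < a₁' :=
    lt_min (lt_min (lt_min (lt_min (div_pos ha₄ hK₁) (div_pos ha₄ hK₂)) (div_pos hc₁ hK₃)) (div_pos heax hK₄)) (div_pos (by norm_num) hK₅)
  refine ⟨a₁', 178 * M, ha₁'0, le_trans hM1 (le_mul_of_one_le_left hM0.le (by norm_num)), ?_⟩
  intro F hF n K hnK ε₁ hε₁ V hVreg U₀ hU₀ hB hε₁a
  -- the five smallness facts carried by `ε₁ ≤ a₁'`
  have h1 : ε₁ ≤ a₄ / (2 * B₀ * (L : ℝ) ^ 3 * B₃) := hε₁a.trans ((min_le_left _ _).trans ((min_le_left _ _).trans ((min_le_left _ _).trans (min_le_left _ _))))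
  have h2 : ε₁ ≤ a₄ / (B₁ * (178 * M + 1) * (L : ℝ) ^ 3 * B₃) :=
    hε₁a.trans ((min_le_left _ _).trans ((min_le_left _ _).trans ((min_le_left _ _).trans (min_le_right _ _))))
  have h3 : ε₁ ≤ c₁ / ((178 * M + 1) * (L : ℝ) ^ 3 * B₃) := hε₁a.trans ((min_le_left _ _).trans ((min_le_left _ _).trans (min_le_right _ _)))
  have h4 : ε₁ ≤ eax / (178 * M * (L : ℝ) ^ 3 * B₃) := hε₁a.trans ((min_le_left _ _).trans (min_le_right _ _))
  have h5 : ε₁ ≤ (1 / 4) / (M * (L : ℝ) ^ 3 * B₃) := hε₁a.trans (min_le_right _ _)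
  have h2B : 2 * B₀ * (L : ℝ) ^ 3 * B₃ * ε₁ ≤ a₄ := by have := (le_div_iff₀ hK₁).1 h1; linarith
  have hε₂a₄ : B₁ * (178 * M * (L : ℝ) ^ 3 * B₃ * ε₁ + (L : ℝ) ^ 3 * ε₁) ≤ a₄ := by
    have := (le_div_iff₀ hK₂).1 h2
    have h0 : (L : ℝ) ^ 3 * ε₁ ≤ (L : ℝ) ^ 3 * B₃ * ε₁ := by
      have := mul_le_mul_of_nonneg_right (le_mul_of_one_le_right hC₁pos.le hB₃1) hε₁.le; exact this
    nlinarith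
  have hsum : 178 * M * (L : ℝ) ^ 3 * B₃ * ε₁ + (L : ℝ) ^ 3 * ε₁ ≤ c₁ := by
    have := (le_div_iff₀ hK₃).1 h3
    have h0 : (L : ℝ) ^ 3 * ε₁ ≤ (L : ℝ) ^ 3 * B₃ * ε₁ := by
      have := mul_le_mul_of_nonneg_right (le_mul_of_one_le_right hC₁pos.le hB₃1) hε₁.le; exact this
    nlinarith
  have heeax : 178 * M * (L : ℝ) ^ 3 * B₃ * ε₁ ≤ eax := by have := (le_div_iff₀ hK₄).1 h4; linarith
  have hquarter : M * (L : ℝ) ^ 3 * B₃ * ε₁ ≤ 1 / 4 := by have := (le_div_iff₀ hK₅).1 h5; linarith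
  -- the (14)-hypotheses at the carrier (`U₀ ∈ 𝔅_k(V)`: b-clause for every b > 0)
  obtain ⟨hreg, hclose⟩ := sat14T3_of_mem_fibre (h := hnK.le) (mul_pos hC₁pos hε₁) hU₀ hB
  -- C-min at ε₄ = a₄: the minimising solution `X`
  obtain ⟨X, hX3, hXh, h20, h21, hXmin⟩ := HC ⟨(F, n, K), hF, hnK⟩ ε₁ a₄ hε₁ le_rfl h2B V U₀ hVreg hreg hclose
  -- (112) ⇒ (19) at M·L³B₃ε₁; its axial representative from (20); row D's engine ⇒ W ∈ 𝔘_k(e), e = 178·M·L³B₃ε₁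
  have hP0 : 0 ≤ (L : ℝ) ^ 3 * B₃ * ε₁ := by positivity
  have h19 : In19 F n K (M * (L : ℝ) ^ 3 * B₃ * ε₁) U₀ (expHermField X) X := by
    have hmono : 3 * B₀ * (L : ℝ) ^ 3 * B₃ * ε₁ ≤ M * (L : ℝ) ^ 3 * B₃ * ε₁ :=
      calc 3 * B₀ * (L : ℝ) ^ 3 * B₃ * ε₁ = (3 * B₀) * ((L : ℝ) ^ 3 * B₃ * ε₁) := by ring
        _ ≤ M * ((L : ℝ) ^ 3 * B₃ * ε₁) := mul_le_mul_of_nonneg_right hM3 hP0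
        _ = M * (L : ℝ) ^ 3 * B₃ * ε₁ := by ring
    exact in19_expHermField_of_nMax19_lt hXh (lt_of_lt_of_le hX3 hmono)
  have hlo : (L : ℝ) ^ 3 * B₃ * ε₁ ≤ M * (L : ℝ) ^ 3 * B₃ * ε₁ :=
    calc (L : ℝ) ^ 3 * B₃ * ε₁ = 1 * ((L : ℝ) ^ 3 * B₃ * ε₁) := (one_mul _).symm
      _ ≤ M * ((L : ℝ) ^ 3 * B₃ * ε₁) := mul_le_mul_of_nonneg_right hM1 hP0
      _ = M * (L : ℝ) ^ 3 * B₃ * ε₁ := by ring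
  obtain ⟨u, _hu, hWfib⟩ := h20 (expHermField X) h19.2.1
  have he0 : 0 < 178 * (M * (L : ℝ) ^ 3 * B₃ * ε₁) := by positivity
  have hRegW : RegPr F n K (178 * (M * (L : ℝ) ^ 3 * B₃ * ε₁)) (GaugeField.gaugeAct u (emb15 U₀ (expHermField X))) :=
    (regPr_gaugeAct_iff F he0.le u _).mpr (regPr_emb15_of_in19 (F := F) (n := n) (K := K) hquarter hlo hreg h19)
  have hWmem : GaugeField.gaugeAct u (emb15 U₀ (expHermField X)) ∈ regFibrePr F n K hnK.le (178 * (M * (L : ℝ) ^ 3 * B₃ * ε₁)) V :=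
    (mem_regFibrePr_iff F).mpr ⟨hWfib, hRegW⟩
  have hO : 178 * M * (L : ℝ) ^ 3 * B₃ * ε₁ = 178 * (M * (L : ℝ) ^ 3 * B₃ * ε₁) := by ring
  refine ⟨GaugeField.gaugeAct u (emb15 U₀ (expHermField X)), by rw [hO]; exact hWmem, ?_⟩
  rw [hO]
  -- a competitor `U ∈ (6)(e) ∩ 𝔅_k(V)`: axial gauge inside its (4)-orbit, COV's chart, gauge invariance of (5)
  intro U hU
  have h14 : Sat14T3 F n K hnK.le ((L : ℝ) ^ 3 * B₃ * ε₁) ((L : ℝ) ^ 3 * ε₁) V U₀ := ⟨hreg, hclose⟩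
  have hεe : 178 * (M * (L : ℝ) ^ 3 * B₃ * ε₁) ≤ min (1 / (6 * C0 3 * (L : ℝ) ^ 3)) (c2' 3 L / (4 * (L : ℝ) ^ 3)) := by
    rw [← heax_def, ← hO]; exact heeax
  have hB₃e : B₃ * ε₁ ≤ 178 * (M * (L : ℝ) ^ 3 * B₃ * ε₁) := by
    have h0 : B₃ * ε₁ ≤ (L : ℝ) ^ 3 * B₃ * ε₁ := by
      rw [mul_assoc]; exact le_mul_of_one_le_left (by positivity) hC₁
    have h178 : (1 : ℝ) ≤ 178 * M := le_trans hM1 (le_mul_of_one_le_left hM0.le (by norm_num))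
    have h1' : (L : ℝ) ^ 3 * B₃ * ε₁ ≤ 178 * (M * (L : ℝ) ^ 3 * B₃ * ε₁) :=
      calc (L : ℝ) ^ 3 * B₃ * ε₁ = 1 * ((L : ℝ) ^ 3 * B₃ * ε₁) := (one_mul _).symm
        _ ≤ (178 * M) * ((L : ℝ) ^ 3 * B₃ * ε₁) := mul_le_mul_of_nonneg_right h178 (by positivity)
        _ = 178 * (M * (L : ℝ) ^ 3 * B₃ * ε₁) := by ring
    exact h0.trans h1'
  obtain ⟨v, hv, hvAx⟩ := axialRepr_print_based_uniform F hF hnK.le hC₁ B₃ _ ε₁ V U₀ U hεe hB₃e h14 hU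
  have hUv : GaugeField.gaugeAct v U ∈ regFibrePr F n K hnK.le (178 * (M * (L : ℝ) ^ 3 * B₃ * ε₁)) V :=
    (gaugeAct_mem_regFibrePr_iff_of_trivial F hnK.le he0.le hv U V).mpr hU
  have hUvax : IsAxialPrint F n K U₀ (GaugeField.gaugeAct v U) := hvAx _
  have hsum' : 178 * (M * (L : ℝ) ^ 3 * B₃ * ε₁) + (L : ℝ) ^ 3 * ε₁ ≤ c₁ := by rw [← hO]; exact hsum
  obtain ⟨u', U₁', X', _hu', hUeq, h19', h20', h21'⟩ :=
    HV F hF n K hnK _ ε₁ (B₁ * (178 * (M * (L : ℝ) ^ 3 * B₃ * ε₁) + (L : ℝ) ^ 3 * ε₁)) he0 hε₁ hsum' le_rfl V U₀ hreg hclose (GaugeField.gaugeAct v U) hUv hUvax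
  have hX'a₄ : nMax19 F n K U₀ X' < a₄ := nMax19_lt_of_in19 h19' (by rw [← hO]; exact hε₂a₄)
  have hcmp := hXmin X' hX'a₄ h19'.1 h20' h21'
  -- gauge invariance of (5): A(W) = A(e^{iX}U₀) ≤ A(e^{iX′}U₀) = A((e^{iX′}U₀)^{u′}) = A(U^v) = A(U)
  have e₁' : U₁' = expHermField X' := eq_expHermField_of_in19 h19'
  have a1 : wilsonAction4 (GaugeField.gaugeAct u (emb15 U₀ (expHermField X))) = wilsonAction4 (emb15 U₀ (expHermField X)) :=
    T4WilsonGaugeFlatDirection.wilsonAction_gaugeAct 1 u _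
  have a2 : wilsonAction4 (GaugeField.gaugeAct v U) = wilsonAction4 U := T4WilsonGaugeFlatDirection.wilsonAction_gaugeAct 1 v U
  have a3 : wilsonAction4 (GaugeField.gaugeAct u' (emb15 U₀ U₁')) = wilsonAction4 (emb15 U₀ U₁') :=
    T4WilsonGaugeFlatDirection.wilsonAction_gaugeAct 1 u' _
  have a4 : wilsonAction4 (emb15 U₀ U₁') = wilsonAction4 U := by rw [← a3, hUeq, a2]
  have a5 : wilsonAction4 (emb15 U₀ (expHermField X')) = wilsonAction4 U := by rw [← e₁']; exact a4
  show wilsonAction4 (GaugeField.gaugeAct u (emb15 U₀ (expHermField X))) ≤ wilsonAction4 U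
  rw [a1, ← a5]
  exact hcmp

end Summit.QuantumFields.YangMills.Theorems.Prop7ExistRouteAlphaMinG

end
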